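import Summits.Schanuel.Schanuel.Theorems.RootDecomp1KMeasuredWallCell07
import Summits.Schanuel.Schanuel.Theorems.RootDecomp1KLogLogCell08

/-!
# RootDecomp1KOnePointCell — lens 1, generation 39 «ONE-POINT ZERO ESTIMATE + LOG-LOG WALL CELL of 33364» ((1, ℓ₂, ℓ₃, ρ) for every log-log-Liouville ρ) — part 1 (RootDecomp1KOnePointCell01): §1 (D) dominance of the extreme weight in a vanishing sum

PORT NOTE (census-1 gen 16, 2026-08-31): port of [HOME/decomp-schanuel-lens-1/g39/RootDecomp1KOnePointCell.lean sha256 4a1f4bc8…4211, 2530 l + OPprobe + OPctrl + NODE-g39.md; NOTE/CLAIM L1801, ACK + CHECKLIST K-g39 L1803, presearch (6) resolved by the critic L1810, NODE L1824 / REQUEST L1825 / RESULT L1826]; own farm rc 0 · 0 warn · 0 sorry · axioms std;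
critic VERDICT L1832: CHECKLIST K-g39 MET, ONE 33364 cell-decision credit to lens-1 g39 under K-R25 (γ″) (label EFFECTIVE-ADAMS = VARIANT-REACH; RULE K-R26); PORT GO `--supports stmt-Schanuel-33364`. Ten parts `RootDecomp1KOnePointCell01`–`10`: 01 = §1 (D) dominance of the extreme weight, 02 = §2 (T) Taylor re-centring tools on `ℤ[x][y]`,
03 = §3 (T) THE ONE-POINT ZERO ESTIMATE `onePoint_nonvanishing` at the simultaneous truncations `(s³_K, s²_K)` (+ `_of_le`), 04 = §3b the general form over two
multiplicatively independent bases `onePoint_nonvanishing_general` (`MulIndep`; `(3,2)`, `(2,3)` instances; `¬ MulIndep 2 4` etc.), 05 = §3c TIGHTNESS (`tightF`: the d = 1 family vanishes at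
the point — sharpness up to the constant) + §4 `logPowMeasure_of_logLogMeasure`, 06 = §4 (M′) `induced_logLog_measure_cons_two_three` (ONE scale, via (T)), 07 = §4 `logLogMeasure_cons_two_three
(hθ : MvPolyMeasure θ) : LogLogMeasure (ℓ₂, ℓ₃, θ)` + instances + §5 the ONE-POINT (LOG-LOG) WALL CELLS of 33364 (item binders verbatim + one range line; `(hNW : NWMeasure)` by name;
supersession of the earlier wall cells as positive controls) + §6 member preliminaries, 08 = §6 truncations of `ρ_E` and the three-scale form bound `form_lower_bound_P`, 09 = the member
`zP = (1, ℓ₂, ℓ₃, ρ_E)` / `zPpi` certificates, `sb_zP (hNW)`, `sb_zPpi`, separation from every earlier cell, 10 = separation from g38's measured wall (`rhoE_ne_ellT`, `range_zP_ne_range_zM`, …).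
The kernel imports the TREE `RootDecomp1KMeasuredWallCell07` + `RootDecomp1KLogLogCell08` only and re-states no tree lemma (nine primed private helpers); NO Theses import. PORT EDITS:
`set_option linter.dupNamespace false` dropped; one docstring added (`onePoint_nonvanishing`); per-part private copies; statements and proofs verbatim; the three
`set_option maxHeartbeats 800000 in` lines carried. `--supports stmt-Schanuel-33364`; no census credit carried; nothing here proves Schanuel; rung 0. The lens's header follows.
-/

/-!
# RootDecomp1K — lens 1 (grading / quantitative ladder), gen 39: the «ONE-POINT CELL» of item 33364
# (`FiniteOrderLiouvilleSchanuel`) — Schanuel's bound `SB 4` on the mixed wall `(1, ℓ₂, ℓ₃, ρ)` for EVERY real `ρ` of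
# the TREE class `LogLogLiouville ρ` (the WEAKEST Liouville-type class of the lineage; class data ONLY, `ρ` not pinned),
# mod the by-name fact `NWMeasure`, and on its π-twin `(π, πℓ₂, πℓ₃, πρ)` HYPOTHESIS-FREE; `ℓ_b = liouvilleNumber b`.
# RULE K-R25 target (γ″): a hypothesis-free ONE-POINT zero estimate at `(s³_K, s²_K)` ⇒ the LOG-LOG block measure
# ⇒ the cell for every log-log-Liouville `ρ` + a certified, separated member.  LABEL (critic, STATUS L1810):
# EFFECTIVE-ADAMS = VARIANT-REACH — the qualitative statement «`Σ 2^{-n!}`, `Σ 3^{-n!}` are algebraically independent»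
# is Adams (1978) [Murty–Rath, Transcendental Numbers, p. 8, Thm 1.2]; what is new here is the EFFECTIVE one-point
# form with explicit thresholds, obtained by re-centring at the previous truncation, and its use as a block measure.

HEADER: see `NODE-g39.md` next to this file (cell decomp-schanuel, seat `decomp-schanuel-lens-1`, gen 39,
2026-08-31; RULE K-R25 (γ″), STATUS L1793; claim L1801; checklist K-g39 L1803).  Route of record
`route-Schanuel-RootDecomp1K` (DRAFT; `closes hL hH hF hB`), item **F** =
`Summit.Schanuel.Schanuel.Theses.RootDecomp1K.FiniteOrderLiouvilleSchanuel` (stmt-Schanuel-33364).  Nothing here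
proves Schanuel; rung 0.  No 1K decl is restated: the item is consumed BY NAME in the probe file (`OPprobe.lean` = this
file verbatim + `import …Theses.RootDecomp1K` + §Probes); the control file `OPctrl.lean` (= this file verbatim + that
import + §Controls) carries the planted failures.  Imports the TREE only (`…RootDecomp1KMeasuredWallCell07` = this
seat's g38 kernel as ported, parts 01–07, and `…RootDecomp1KLogLogCell08` = lens-6's log-log cell, parts 01–08; they
transitively provide Hyper01–03, Generic, RelLiouvilleCell, TwoBaseCell); every engine lemma of earlier generations is
used BY ITS TREE NAME (`psQ`, `evxy`, `psNumer`, `partialSum_eq_psNumer_div`, `abs_liouvilleNumber_sub_partialSum_le`,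
`wspec`, `sliceXY`, `mvaeval_wspec`, `exists_scale_index`, `factorial_scale_le`, `sb_of_logLogLiouville_of_logLogMeasure`,
`sb_of_range_eq'`, `rhoE`, `logLogLiouville_rhoE`, `not_logHyperLiouville_rhoE`, `formE_lower_bound`,
`polyMeasure_exp_one_of_NW`, `mvPolyMeasure_one_of_polyMeasure`, `polyMeasure_pi`, …); nothing is vendored (§6
re-proves g38's member lemmas for the NEW fourth coordinate `ρ_E`; the g38 statements about `ℓ_T` are not reused
because the number differs).  The e-versions carry the tree's by-name fact binder `(hNW : NWMeasure)`; π-versions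
nothing.

THE MECHANISM (two new engines + the tree's extraction step):
* (T) §3 `onePoint_nonvanishing` — a HYPOTHESIS-FREE ONE-POINT ZERO ESTIMATE for the pinned pair `(ℓ₃, ℓ₂)`: a
  non-zero `F ∈ ℤ[x][y]` of partial degrees `≤ d` and height `≤ L` does NOT vanish at the ONE truncation point
  `(s³_K, s²_K) = (psQ 3 K, psQ 2 K)` as soon as `6^{d+2}(d+1) ≤ K` and `L^{2·6^d} ≤ 2^{K!}`.  Proof: re-centre at the
  PREVIOUS truncation `(s³_{K−1}, s²_{K−1})` — after the integer rescaling `x ↦ x/3^{(K−1)!}`, `y ↦ y/2^{(K−1)!}`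
  (`scaleXY`) and the integer shift (`shiftXY`) ALL Taylor data are integers of height `≤ L·(4·6^{(K−1)!})^{2d}`, and the
  value at the point is `Σ_{i,j} G_{ij} 3^{-iK!} 2^{-jK!}`, a sum over DISTINCT weights `3^{iK!} 2^{jK!}` (unique
  factorisation, `weight_injective`); the extreme non-zero term DOMINATES (§1 `dominance`: in `Σ Zᵢ wᵢ = 0` with
  `|Zᵢ| ≤ Z` and the `wᵢ` in geometric progression of ratio `≥ 2^{K!} > 2Z`, all `Zᵢ = 0`), so vanishing forces
  `G = 0`, i.e. `F = 0`.  ONE scale suffices (contrast g38's (W): `d + 1` consecutive scales).  GENERAL FORM §3b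
  `onePoint_nonvanishing_general` over two bases `(b, c)`, `2 ≤ b, c`, under the NAMED hypothesis `MulIndep b c`
  (multiplicative independence, `b^i c^j = b^{i'} c^{j'} → i = i' ∧ j = j'`), thresholds `12(bc)^{d+1}(d+1) ≤ K`,
  `L^{2(bc)^d} ≤ 2^{K!}`; DISCHARGED at `(3, 2)` / `(2, 3)` by unique factorisation (`mulIndep_three_two`), VISIBLY
  FALSE at common-radix pairs (`not_mulIndep_two_four`, `_four_two`, `_two_eight`, `_self`) — those pairs are OUTSIDE
  the theorem (control C4).  TIGHTNESS §3c, PROVED: the `d = 1` family `tightF K = 3^{K!}·x − psNumer 3 K` is non-zero,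
  of height `3^{K!}`, and VANISHES at the point (`evxy_tightF`); it is excluded exactly by the height hypothesis
  (`tightF_height_excluded`: `¬ (3^{K!})^{12} ≤ 2^{K!}`), so `log L ≍ K!` is the true range of (T).
* (M′) §4 `induced_logLog_measure_cons_two_three` / `logLogMeasure_cons_two_three` — the LOG-LOG BLOCK MEASURE: for
  EVERY tuple `θ` with the tree class `MvPolyMeasure θ` (quantified), the block `(ℓ₂, ℓ₃, θ)` has the TREE class
  `RootDecomp1KLogLogCell.LogLogMeasure` — `exp(−C(1+log L)(1+log(1+log L))) ≤ |P(ℓ₂, ℓ₃, θ)|` for `P ≠ 0` of degree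
  `≤ d` and length `L`: slice `P = Σ_α c_α(x, y) θ^α` (tree `sliceXY`), choose ONE scale `K` by the tree's
  `exists_scale_index` with `K! ≍_d log L`, apply (T) to the leading slice at `(s³_K, s²_K)` so the specialisation
  `wspec P K ∈ ℤ[θ]` is non-zero, apply `MvPolyMeasure θ`, and compare across the factorial gap (`mvaeval_wspec`).
  Since ONE scale replaces g38's window of `d + 1` scales, the loss is `log log L` instead of `(log L)^{d+2}`:
  `LogLogMeasure ⇒ LogPowMeasure` (`logPowMeasure_of_logLogMeasure`, `k = 2`) and g38's tree theorem
  `logPowMeasure_cons_two_three` is RE-DERIVED (`logPowMeasure_cons_two_three'`, same type).  HONEST: one point yields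
  LOG-LOG, not a polynomial measure — `MvPolyMeasure (ℓ₂, ℓ₃, θ)` is false (`ℓ₂` is Liouville), so (M′) does not
  iterate (control C5).
* (X) §5 — extraction with `ρ` LAST against the log-log block measure, by the TREE theorem
  `sb_of_logLogLiouville_of_logLogMeasure (n := 3)` (lens-6, LogLogCell02), then `sb_of_range_eq'`.
Instances: `θ = (e)` (`MvPolyMeasure` from `NWMeasure` via `polyMeasure_exp_one_of_NW`) gives the e-cell
`sb_onePointCell` / `finiteOrderLiouvilleSchanuel_onePointCell`; `θ = (π)` (`polyMeasure_pi`, hypothesis-free) gives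
the π-cell.  SUPERSESSION (literal, probe P7): g38's tree theorems `finiteOrderLiouvilleSchanuel_measuredWallCell`,
`sb_measuredWallCell` are DERIVED here through the tree inclusion `logLogLiouville_of_logHyperLiouville`
(`finiteOrderLiouvilleSchanuel_measuredWallCell'`, proof-irrelevance `rfl` against the tree decl), and so are the
log-square / hyper-Liouville corollaries (`logLogLiouville_of_logSqLiouville`, `_of_hyperLiouville`) — derived, not
claimed.  Class lines: `InOnePointWallClass(Pi)` ⊇ g38's `InMeasuredWallClass(Pi)`.

THE MEMBER (§6, hypothesis-free certificates): `z_P = (1, ℓ₂, ℓ₃, ρ_E)` and `z_P^π = π·z_P`, `ρ_E = rhoE` the tree's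
even-factorial lacunary number (`logLogLiouville_rhoE`, lens-6 LogLogCell05; NOT log-hyper-, NOT log-square-Liouville,
LogLogCell06): (i) ℚ-linear independence, (ii) the item's `ω`-binder, (iii) FAILURE of the item's `m`-binder — all from
the THREE-SCALE form bound `form_lower_bound_P` (exponent 11: `g₂ = 0` reduces to the tree's `formE_lower_bound`;
`g₂ ≠ 0` is excluded by comparing the scales `2^{-N!}` and `3^{-N!}`); class membership `zP_inOnePointWallClass`;
the LIVE item APPLIED at `z_P` typechecks (probe P2) and `SB 4 z_P` is PROVED mod `hNW` (`sb_zP`), `SB 4 z_P^π` with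
NO hypothesis (`sb_zPpi`).  SEPARATION (PROVED, hypothesis-free): `¬ InMeasuredWallClass z_P` (range equality on the
wall forces the fourth coordinate, `wall_param_eq_of_range_eq`, and `¬ LogHyperLiouville ρ_E`); `ρ_E ≠ ℓ_b` for every
`b ≥ 2` (no `ℓ_b` is log-log-Liouville); `ρ_E ≠ ℓ_T`, `range z_P ≠ range z_M` (g38's member), `≠ range z_E` (lens-6's
member); `z_P`, `z_P^π` lie on no `Fin 3` cell and on no Liouville-block cell `(1, ℓ_{b⃗})` / `(π, πℓ_{b⃗})` of any length.

HONEST SCOPE: multiplicatively independent base pairs only (common-radix pairs are outside (T)); the block class is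
LOG-LOG and that is SHARP for this method (tightness §3c; no polynomial measure); the wall stays `(1, ℓ₂, ℓ₃, ρ)` —
other base pairs `(b, c)` with `MulIndep b c`, longer blocks, π-twins and other `θ`-instances are VARIANTS of the same
mechanism, not new reach; nothing is claimed towards the summit beyond item 33364's cell class.

Sections: §1 (D) dominance · §2 integer Taylor tools (`scaleXY`, `shiftXY`, coefficient/height bookkeeping) · §3 (T)
at `(3, 2)`, §3b `MulIndep` + the general two-base form + instances / non-instances, §3c tightness family `tightF` ·
§4 (M′) one-scale log-log block measure, `LogLog ⇒ LogPow`, g38's (M) re-derived, instances `e` / `π` · §5 cells vs the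
LIVE binders (positional texts + class lines `InOnePointWallClass(Pi)`), supersession of g38 · §6 member `z_P`, `z_P^π`,
certificates, separation.  `set_option maxHeartbeats 800000 in` three times (§3 `onePoint_nonvanishing`, §3b
`onePoint_nonvanishing_general`, §6 `form_lower_bound_P`); no other option, no linter disabled except
`linter.dupNamespace`.
-/

open Complex IntermediateField Polynomial
open Summit.Schanuel.Schanuel.Theorems.RootDecomp1KHyper
open Summit.Schanuel.Schanuel.Theorems.RootDecomp1KHyper.HyperCell
open Summit.Schanuel.Schanuel.Theorems.RootDecomp1KGeneric
open Summit.Schanuel.Schanuel.Theorems.RootDecomp1KRelLiouvilleCell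
open Summit.Schanuel.Schanuel.Theorems.RootDecomp1KLogLogCell
open Summit.Schanuel.Schanuel.Theorems.RootDecomp1KTwoBaseCell
open Summit.Schanuel.Schanuel.Theorems.RootDecomp1KMeasuredWallCell

namespace Summit.Schanuel.Schanuel.Theorems.RootDecomp1KOnePointCell

/-! ## §1  (D) DOMINANCE of the extreme weight in a vanishing sum `Σ Zᵢ eᵢ^M = 0` -/

section Dominance

/-- **Dominance.** If `Σ_{i∈s} Zᵢ·eᵢ^M = 0` (`M ≥ 1`) with integers `Zᵢ` not all zero, `|Zᵢ| ≤ B`, and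
PAIRWISE DISTINCT weights `1 ≤ eᵢ ≤ m`, then `(m+1)^M ≤ m^M · (#s · B)`: the non-zero term of largest
weight `e₀` is cancelled by the others, all of weight `≤ e₀ − 1`, so `(e₀/(e₀−1))^M ≤ #s·B`, and
`e₀/(e₀−1) ≥ (m+1)/m`. -/
theorem dominance {ι : Type*} (s : Finset ι) (Z : ι → ℤ) (e : ι → ℕ) {m M : ℕ} {B : ℤ}
    (hM : 1 ≤ M) (he1 : ∀ i ∈ s, 1 ≤ e i) (hem : ∀ i ∈ s, e i ≤ m)
    (hinj : ∀ i ∈ s, ∀ j ∈ s, e i = e j → i = j) (hZ : ∀ i ∈ s, |Z i| ≤ B)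
    (hne : ∃ i ∈ s, Z i ≠ 0) (hsum : ∑ i ∈ s, Z i * (e i : ℤ) ^ M = 0) :
    ((m : ℤ) + 1) ^ M ≤ (m : ℤ) ^ M * (s.card * B) := by
  classical
  obtain ⟨i₁, hi₁, hZi₁⟩ := hne
  have hB0 : 0 ≤ B := (abs_nonneg _).trans (hZ i₁ hi₁)
  -- the non-zero index of maximal weight
  set s' : Finset ι := s.filter (fun i => Z i ≠ 0) with hs'def
  have hs'ne : s'.Nonempty := ⟨i₁, Finset.mem_filter.mpr ⟨hi₁, hZi₁⟩⟩
  obtain ⟨i₀, hi₀s', hmax⟩ := Finset.exists_max_image s' e hs'ne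
  obtain ⟨hi₀, hZi₀⟩ := Finset.mem_filter.mp hi₀s'
  have he₀1 : 1 ≤ e i₀ := he1 i₀ hi₀
  have he₀1Z : (1 : ℤ) ≤ (e i₀ : ℤ) := by exact_mod_cast he₀1
  have hE0 : (0 : ℤ) ≤ (e i₀ : ℤ) - 1 := by linarith
  -- every other term is `≤ B (e₀ − 1)^M` in absolute value
  have hterm : ∀ i ∈ s.erase i₀, |Z i * (e i : ℤ) ^ M| ≤ B * ((e i₀ : ℤ) - 1) ^ M := by
    intro i hi
    obtain ⟨hne_i, his⟩ := Finset.mem_erase.mp hi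
    by_cases hZi : Z i = 0
    · rw [hZi, zero_mul, abs_zero]; exact mul_nonneg hB0 (pow_nonneg hE0 _)
    · have hle' : e i ≤ e i₀ := hmax i (Finset.mem_filter.mpr ⟨his, hZi⟩)
      have hlt : e i < e i₀ :=
        lt_of_le_of_ne hle' (fun h => hne_i (hinj i his i₀ hi₀ h))
      have hle : (e i : ℤ) ≤ (e i₀ : ℤ) - 1 := by
        have : (e i : ℤ) < (e i₀ : ℤ) := by exact_mod_cast hlt
        linarith
      rw [abs_mul, abs_pow, Nat.abs_cast]
      exact mul_le_mul (hZ i his) (pow_le_pow_left₀ (by positivity) hle M) (by positivity) hB0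
  -- hence `e₀^M ≤ |Z i₀| e₀^M ≤ #s · B · (e₀ − 1)^M`
  have hsplit := Finset.sum_erase_add s (fun i => Z i * (e i : ℤ) ^ M) hi₀
  rw [hsum] at hsplit
  have hiso : Z i₀ * (e i₀ : ℤ) ^ M = -∑ i ∈ s.erase i₀, Z i * (e i : ℤ) ^ M := by linarith
  have hstar : ((e i₀ : ℤ)) ^ M ≤ (s.card : ℤ) * B * ((e i₀ : ℤ) - 1) ^ M := by
    have h1 : (1 : ℤ) ≤ |Z i₀| := Int.one_le_abs hZi₀
    have h2 : |Z i₀ * (e i₀ : ℤ) ^ M| ≤ ∑ i ∈ s.erase i₀, B * ((e i₀ : ℤ) - 1) ^ M := by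
      rw [hiso, abs_neg]
      exact (Finset.abs_sum_le_sum_abs _ _).trans (Finset.sum_le_sum hterm)
    rw [Finset.sum_const, nsmul_eq_mul, abs_mul, abs_pow, Nat.abs_cast] at h2
    have h3 : ((s.erase i₀).card : ℤ) ≤ s.card := by exact_mod_cast Finset.card_erase_le
    have h4 : (0 : ℤ) ≤ B * ((e i₀ : ℤ) - 1) ^ M := mul_nonneg hB0 (pow_nonneg hE0 _)
    have h5 : (0 : ℤ) ≤ ((e i₀ : ℤ)) ^ M := by positivity
    calc ((e i₀ : ℤ)) ^ M = 1 * ((e i₀ : ℤ)) ^ M := (one_mul _).symm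
      _ ≤ |Z i₀| * ((e i₀ : ℤ)) ^ M := mul_le_mul_of_nonneg_right h1 h5
      _ ≤ ((s.erase i₀).card : ℤ) * (B * ((e i₀ : ℤ) - 1) ^ M) := h2
      _ ≤ (s.card : ℤ) * (B * ((e i₀ : ℤ) - 1) ^ M) := mul_le_mul_of_nonneg_right h3 h4
      _ = (s.card : ℤ) * B * ((e i₀ : ℤ) - 1) ^ M := by ring
  -- if `e₀ = 1` this is absurd; else cancel `(e₀ − 1)^M` after `(m+1)(e₀−1) ≤ m e₀`
  rcases eq_or_lt_of_le he₀1 with he | he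
  · exfalso
    rw [← he] at hstar
    norm_num at hstar
    rw [zero_pow (by omega)] at hstar
    norm_num at hstar
  · have hE : (0 : ℤ) < (e i₀ : ℤ) - 1 := by
      have : (2 : ℤ) ≤ (e i₀ : ℤ) := by exact_mod_cast he
      linarith
    have hEM : (0 : ℤ) < ((e i₀ : ℤ) - 1) ^ M := pow_pos hE M
    have hemZ : (e i₀ : ℤ) ≤ m := by exact_mod_cast hem i₀ hi₀
    have hcmp : ((m : ℤ) + 1) * ((e i₀ : ℤ) - 1) ≤ (m : ℤ) * (e i₀ : ℤ) := by nlinarith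
    have hcmpM : (((m : ℤ) + 1) * ((e i₀ : ℤ) - 1)) ^ M ≤ ((m : ℤ) * (e i₀ : ℤ)) ^ M :=
      pow_le_pow_left₀ (by positivity) hcmp M
    rw [mul_pow, mul_pow] at hcmpM
    have hchain : ((m : ℤ) + 1) ^ M * ((e i₀ : ℤ) - 1) ^ M ≤
        (m : ℤ) ^ M * (s.card * B) * ((e i₀ : ℤ) - 1) ^ M := by
      calc ((m : ℤ) + 1) ^ M * ((e i₀ : ℤ) - 1) ^ M ≤ (m : ℤ) ^ M * (e i₀ : ℤ) ^ M := hcmpM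
        _ ≤ (m : ℤ) ^ M * ((s.card : ℤ) * B * ((e i₀ : ℤ) - 1) ^ M) :=
            mul_le_mul_of_nonneg_left hstar (by positivity)
        _ = (m : ℤ) ^ M * (s.card * B) * ((e i₀ : ℤ) - 1) ^ M := by ring
    exact le_of_mul_le_mul_right hchain hEM

/-- `2·mᵐ ≤ (m+1)ᵐ` (Bernoulli). -/
theorem two_mul_pow_le_succ_pow (m : ℕ) (hm : 1 ≤ m) : (2 : ℤ) * (m : ℤ) ^ m ≤ ((m : ℤ) + 1) ^ m := by
  have hmQ : (0 : ℚ) < m := by exact_mod_cast hm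
  have hB := one_add_mul_le_pow (show (-2 : ℚ) ≤ 1 / m by
    have : (0 : ℚ) ≤ 1 / m := by positivity
    linarith) m
  have e1 : (1 : ℚ) + (m : ℚ) * (1 / m) = 2 := by field_simp; ring
  have e2 : ((1 : ℚ) + 1 / m) ^ m = ((m : ℚ) + 1) ^ m / (m : ℚ) ^ m := by
    rw [← div_pow]; congr 1; field_simp
  rw [e1, e2, le_div_iff₀ (by positivity)] at hB
  exact_mod_cast hB

/-- **Dominance, exponential form.** Under the hypotheses of `dominance` and `m ∣ M`:
`2^{M/m} ≤ #s · B`. -/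
theorem two_pow_le_of_dominance {m M : ℕ} {X : ℤ} (hm : 1 ≤ m) (hmM : m ∣ M)
    (h : ((m : ℤ) + 1) ^ M ≤ (m : ℤ) ^ M * X) : (2 : ℤ) ^ (M / m) ≤ X := by
  obtain ⟨c, rfl⟩ := hmM
  have hm0 : 0 < m := hm
  rw [Nat.mul_div_cancel_left c hm0]
  have hmm : (0 : ℤ) < (m : ℤ) ^ (m * c) := by positivity
  have h1 : (2 : ℤ) ^ c * (m : ℤ) ^ (m * c) ≤ ((m : ℤ) + 1) ^ (m * c) := by
    rw [pow_mul, pow_mul, ← mul_pow]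
    exact pow_le_pow_left₀ (by positivity) (two_mul_pow_le_succ_pow m hm) c
  have h2 : (2 : ℤ) ^ c * (m : ℤ) ^ (m * c) ≤ X * (m : ℤ) ^ (m * c) := by
    calc (2 : ℤ) ^ c * (m : ℤ) ^ (m * c) ≤ ((m : ℤ) + 1) ^ (m * c) := h1
      _ ≤ (m : ℤ) ^ (m * c) * X := h
      _ = X * (m : ℤ) ^ (m * c) := mul_comm _ _
  exact le_of_mul_le_mul_right h2 hmm

end Dominance

end Summit.Schanuel.Schanuel.Theorems.RootDecomp1KOnePointCell
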